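import Mathlib
import Summits.NavierStokesRegularity.NavierStokesRegularity.Theses.AmplitudeIndex
import Summits.NavierStokesRegularity.NavierStokesRegularity.Theorems.DssFarFieldSlavingBlowupTypeIDssProfileSimilarityEnstrophyIdentity
import Summits.NavierStokesRegularity.NavierStokesRegularity.Theorems.DssFarFieldSlavingBlowupTypeIDssProfileSimilarityEnstrophyLambCore
import Summits.NavierStokesRegularity.NavierStokesRegularity.Theorems.QuantisedSymmetryPolyhedralDssProfileExistsStubAncientMildOfClassicalTypeI
import Literature.Analysis.FluidPDE.SpaceTimeCalculusC1
import HarnessLib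

/-!
# `AmplitudeIndex.AmplitudeMountainPass` — the similarity-enstrophy identity along a Type-I
  classical orbit, integrated in similarity time (route `AmplitudeIndex`,
  item stmt-NavierStokesRegularity-10564, support; card (F1))

**Statement.** For a classical Navier–Stokes solution `v` on `t < 0` (`ν = 1`, zero force) with the
parabolic Type-I envelope up to third derivatives, `‖Dⁿv(t,x)‖ ≤ C_n/(‖x‖ + √(−t))^{n+1}` (`n ≤ 3`),
the Leray orbit `U(s,y) = e^{−s/2} v(−e^{−s}, e^{−s/2}y)` satisfies, for `s₁ ≤ s₂`,
`∫_{s₁}^{s₂} P_s(U(s),U(s)) ds = ‖curl U(s₂)‖²₂ − ‖curl U(s₁)‖²₂ + ∫_{s₁}^{s₂}(‖∇curl U‖²₂ + ¼‖curl U‖²₂) ds`,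
where `P_s(w,w') = ∫ (−Σᵢ⟪∂ᵢcurl w, ∂ᵢcurl w'⟫ − ¼⟪curl w, curl w'⟫ + ⟪U×curl w + w×curl U, curl curl w'⟫)`.

PROOF. The envelope makes `v` a KNSS-gauge Type-I ancient mild field (`isTypeIAncientMild_of_classical_typeI`,
`n = 0`) satisfying the decay hypothesis (D) at `k = 1, 2, 3`; the pub-ns-dss cell's kernel-checked
similarity-enstrophy identity (`SimilarityEnstrophy.similarityEnstrophy_hasDerivAt`:
`Z' = 2(−∫|∇Ω|²_F − ¼Z + ∫⟪Ω, DU Ω⟫)`, `Z = ∫‖Ω‖²`, `Ω = curl U`) and the Lamb form of the stretching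
(`SimilarityEnstrophy.integral_stretching_eq_integral_inner_lamb`: `∫⟪Ω, DU Ω⟫ = ∫⟪U, Ω × curl Ω⟫`) give
`P_s(U,U) = Z'(s) + ∫|∇Ω|²_F + ¼Z` slice by slice; the three slice functionals are continuous in `s`
(dominated convergence with the (D)-dominations, joint continuity of the similarity derivatives), so
the fundamental theorem of calculus integrates the identity.

HONEST FRAMING: an identity for a HYPOTHETICAL orbit under a stated envelope hypothesis; nothing
here bears on the regularity problem itself.
-/

noncomputable section

set_option linter.dupNamespace false

namespace Summit.NavierStokesRegularity.NavierStokesRegularity.Theorems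

namespace AmplitudeMountainPassProof

open MeasureTheory Set Filter Topology Function Metric InnerProductSpace
open scoped RealInnerProductSpace ContDiff
open Literature.Analysis Literature.Analysis.FluidPDE
open Summit.NavierStokesRegularity.NavierStokesRegularity.Theorems.SimilarityEnstrophy
open Summit.NavierStokesRegularity.NavierStokesRegularity.Theorems.GaussianGap
open Summit.NavierStokesRegularity.NavierStokesRegularity.Theorems.PlanarEnergyAPriori

variable {M : ℝ} {V : ℝ → EuclideanSpace ℝ (Fin 3) → EuclideanSpace ℝ (Fin 3)}

/-! ### Pointwise algebra -/

/-- Cyclic scalar triple product for the tree's `cross` on `ℝ³`: `⟪a × b, c⟫ = ⟪a, b × c⟫`. [folklore] -/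
theorem inner_cross_left_eq_inner_cross_right (a b c : EuclideanSpace ℝ (Fin 3)) :
    ⟪cross a b, c⟫ = ⟪a, cross b c⟫ := by
  simp only [PiLp.inner_apply, RCLike.inner_apply, conj_trivial, Fin.sum_univ_three]
  simp [cross, cross_apply]
  ring

/-- `Σᵢ ⟪L eᵢ, L eᵢ⟫ = |L|²_F` (standard basis of `ℝ³`). [folklore] -/
theorem sum_inner_apply_single_self (L : EuclideanSpace ℝ (Fin 3) →L[ℝ] EuclideanSpace ℝ (Fin 3)) :
    ∑ i : Fin 3, ⟪L (EuclideanSpace.single i (1 : ℝ)), L (EuclideanSpace.single i (1 : ℝ))⟫ =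
      frobeniusNormSq L := by
  rw [frobeniusNormSq_eq_sum (EuclideanSpace.basisFun (Fin 3) ℝ)]
  refine Finset.sum_congr rfl fun i _ => ?_
  rw [EuclideanSpace.basisFun_apply, real_inner_self_eq_norm_sq]

/-! ### Joint continuity of the similarity derivatives -/

/-- `(s, y) ↦ DU(s)(y)` is continuous (jointly smooth orbit). [folklore] -/
theorem continuous_fderiv_lerayOrbit_uncurry (hV : IsTypeIAncientMild M V) :
    Continuous fun p : ℝ × EuclideanSpace ℝ (Fin 3) => fderiv ℝ (lerayOrbit V p.1) p.2 := by
  have hU : ContDiffOn ℝ 1 (uncurry (lerayOrbit V)) (univ ×ˢ univ) :=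
    ((contDiff_uncurry_lerayOrbit_of_typeI hV).of_le (by exact_mod_cast le_top)).contDiffOn
  have h := continuousOn_fderiv_slice_of_contDiffOn hU uniqueDiffOn_univ
  rw [univ_prod_univ] at h
  exact continuousOn_univ.1 h

/-- `(s, y) ↦ Ω(s)(y)` is continuous (`Ω = curlCLM ∘ DU`). [folklore] -/
theorem continuous_lerayVorticity_uncurry (hV : IsTypeIAncientMild M V) :
    Continuous fun p : ℝ × EuclideanSpace ℝ (Fin 3) => lerayVorticity V p.1 p.2 := by
  have h := continuous_fderiv_lerayOrbit_uncurry hV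
  have e : (fun p : ℝ × EuclideanSpace ℝ (Fin 3) => lerayVorticity V p.1 p.2) =
      fun p => curlCLM (fderiv ℝ (lerayOrbit V p.1) p.2) := by
    funext p; rfl
  rw [e]
  exact curlCLM.continuous.comp h

/-- The slice derivative of the orbit is the joint derivative composed with the injection `inr`. -/
theorem fderiv_lerayOrbit_slice_eq (hV : IsTypeIAncientMild M V) (p : ℝ × EuclideanSpace ℝ (Fin 3)) :
    fderiv ℝ (lerayOrbit V p.1) p.2 =
      (fderiv ℝ (uncurry (lerayOrbit V)) p).comp (ContinuousLinearMap.inr ℝ ℝ (EuclideanSpace ℝ (Fin 3))) := by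
  have hd : DifferentiableAt ℝ (uncurry (lerayOrbit V)) (p.1, p.2) :=
    ((contDiff_uncurry_lerayOrbit_of_typeI hV).differentiable (by simp)) _
  have h := hd.hasFDerivAt.comp p.2 (hasFDerivAt_prodMk_right (𝕜 := ℝ) p.1 p.2)
  exact h.fderiv

/-- `(s, y) ↦ Ω(s)(y)` is jointly `C¹` (indeed smooth): `Ω = curlCLM ∘ (D(uncurry U) ∘L inr)`. [folklore] -/
theorem contDiff_lerayVorticity_uncurry (hV : IsTypeIAncientMild M V) :
    ContDiff ℝ 1 (uncurry (lerayVorticity V)) := by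
  have hU := contDiff_uncurry_lerayOrbit_of_typeI hV
  have hDU : ContDiff ℝ 1 (fderiv ℝ (uncurry (lerayOrbit V))) :=
    hU.fderiv_right (m := 1) (by norm_cast)
  have hW : ContDiff ℝ 1 fun p : ℝ × EuclideanSpace ℝ (Fin 3) =>
      (fderiv ℝ (uncurry (lerayOrbit V)) p).comp
        (ContinuousLinearMap.inr ℝ ℝ (EuclideanSpace ℝ (Fin 3))) :=
    hDU.clm_comp contDiff_const
  have e : uncurry (lerayVorticity V) = fun p : ℝ × EuclideanSpace ℝ (Fin 3) =>
      curlCLM ((fderiv ℝ (uncurry (lerayOrbit V)) p).comp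
        (ContinuousLinearMap.inr ℝ ℝ (EuclideanSpace ℝ (Fin 3)))) := by
    funext p
    obtain ⟨s, y⟩ := p
    show lerayVorticity V s y = _
    rw [show lerayVorticity V s y = curlCLM (fderiv ℝ (lerayOrbit V s) y) from rfl,
      fderiv_lerayOrbit_slice_eq hV (s, y)]
  rw [e]
  exact curlCLM.contDiff.comp hW

/-- `(s, y) ↦ DΩ(s)(y)` is continuous. [folklore] -/
theorem continuous_fderiv_lerayVorticity_uncurry (hV : IsTypeIAncientMild M V) :
    Continuous fun p : ℝ × EuclideanSpace ℝ (Fin 3) => fderiv ℝ (lerayVorticity V p.1) p.2 := by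
  have hΩ : ContDiffOn ℝ 1 (uncurry (lerayVorticity V)) (univ ×ˢ univ) :=
    (contDiff_lerayVorticity_uncurry hV).contDiffOn
  have h := continuousOn_fderiv_slice_of_contDiffOn hΩ uniqueDiffOn_univ
  rw [univ_prod_univ] at h
  exact continuousOn_univ.1 h

/-! ### Continuity in similarity time of the three slice functionals -/

section SliceFunctionals

variable (hV : IsTypeIAncientMild M V) {C₁ C₂ C₃ : ℝ}
  (hD1 : ∀ t < 0, ∀ x, (‖x‖ + Real.sqrt (-t)) ^ (1 + 1) * ‖iteratedFDeriv ℝ 1 (V t) x‖ ≤ C₁)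
  (hD2 : ∀ t < 0, ∀ x, (‖x‖ + Real.sqrt (-t)) ^ (2 + 1) * ‖iteratedFDeriv ℝ 2 (V t) x‖ ≤ C₂)
  (hD3 : ∀ t < 0, ∀ x, (‖x‖ + Real.sqrt (-t)) ^ (3 + 1) * ‖iteratedFDeriv ℝ 3 (V t) x‖ ≤ C₃)
include hV

omit hV in
/-- `y ↦ K (1 + ‖y‖)^{−6}` is integrable on `ℝ³`. [folklore] -/
theorem integrable_const_mul_decay_six (K : ℝ) :
    Integrable fun y : EuclideanSpace ℝ (Fin 3) => K * (1 + ‖y‖) ^ (-(6 : ℝ)) := by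
  have hc : Continuous fun y : EuclideanSpace ℝ (Fin 3) => K * (1 + ‖y‖) ^ (-(6 : ℝ)) :=
    continuous_const.mul ((continuous_const.add continuous_norm).rpow_const
      fun y => Or.inl (add_pos_of_pos_of_nonneg one_pos (norm_nonneg y)).ne')
  refine integrable_of_norm_le_const_mul_decay hc (r := 6) (C₁ := |K|) (C₂ := 1)
    (by rw [finrank_euclideanSpace_fin]; norm_num) fun y => ?_
  rw [norm_mul, Real.norm_eq_abs, Real.norm_of_nonneg (Real.rpow_nonneg (by positivity) _), one_mul]

include hD2 in
/-- **`s ↦ ∫|∇Ω(s)|²_F` is continuous** (dominated convergence; domination `3(‖curl‖C₂)²(1+|y|)^{−6}`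
uniform in `s` under (D) at `k = 2`; joint continuity of `DΩ`). [this file] -/
theorem continuous_integral_frobeniusNormSq :
    Continuous fun s => ∫ y, frobeniusNormSq (fderiv ℝ (lerayVorticity V s) y) := by
  have hj := continuous_fderiv_lerayVorticity_uncurry hV
  have hfrob : Continuous fun p : ℝ × EuclideanSpace ℝ (Fin 3) =>
      frobeniusNormSq (fderiv ℝ (lerayVorticity V p.1) p.2) := by
    unfold frobeniusNormSq
    exact continuous_finsetSum _ fun i _ => ((hj.clm_apply continuous_const).norm).pow 2
  refine continuous_of_dominated (bound := fun y => 3 * (‖curlCLM‖ * C₂) ^ 2 * (1 + ‖y‖) ^ (-(6 : ℝ)))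
    (fun s => ?_) (fun s => Eventually.of_forall fun y => ?_) (integrable_const_mul_decay_six _)
    (Eventually.of_forall fun y => ?_)
  · exact ((hfrob.comp (Continuous.prodMk_right s)).congr fun _ => rfl).aestronglyMeasurable
  · rw [Real.norm_of_nonneg (frobeniusNormSq_nonneg _)]
    have h := norm_fderiv_lerayVorticity_le_decay hV hD2 s y
    calc frobeniusNormSq (fderiv ℝ (lerayVorticity V s) y)
        ≤ 3 * ‖fderiv ℝ (lerayVorticity V s) y‖ ^ 2 := frobeniusNormSq_le_three_mul _
      _ ≤ 3 * (‖curlCLM‖ * C₂ * (1 + ‖y‖) ^ (-(3 : ℝ))) ^ 2 :=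
          mul_le_mul_of_nonneg_left (pow_le_pow_left₀ (norm_nonneg _) h 2) (by norm_num)
      _ = 3 * (‖curlCLM‖ * C₂) ^ 2 * ((1 + ‖y‖) ^ (-(3 : ℝ)) * (1 + ‖y‖) ^ (-(3 : ℝ))) := by ring
      _ = 3 * (‖curlCLM‖ * C₂) ^ 2 * (1 + ‖y‖) ^ (-(6 : ℝ)) := by
          rw [SlabLaw.rpow_neg_mul_rpow_neg]; norm_num
  · exact (hfrob.comp (Continuous.prodMk_left y)).congr fun _ => rfl

include hD1 in
/-- **`s ↦ ∫⟪Ω(s), DU(s)Ω(s)⟫` is continuous** (domination `‖curl‖²C₁³(1+|y|)^{−6}` under (D) at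
`k = 1`; joint continuity of `Ω`, `DU`). [this file] -/
theorem continuous_integral_stretching :
    Continuous fun s => ∫ y,
      ⟪lerayVorticity V s y, fderiv ℝ (lerayOrbit V s) y (lerayVorticity V s y)⟫ := by
  have hΩj := continuous_lerayVorticity_uncurry hV
  have hDUj := continuous_fderiv_lerayOrbit_uncurry hV
  have hint : Continuous fun p : ℝ × EuclideanSpace ℝ (Fin 3) =>
      ⟪lerayVorticity V p.1 p.2, fderiv ℝ (lerayOrbit V p.1) p.2 (lerayVorticity V p.1 p.2)⟫ :=
    hΩj.inner (hDUj.clm_apply hΩj)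
  have hC₁ := decayConst_nonneg hD1
  refine continuous_of_dominated
    (bound := fun y => ‖curlCLM‖ ^ 2 * C₁ ^ 3 * (1 + ‖y‖) ^ (-(6 : ℝ)))
    (fun s => ?_) (fun s => Eventually.of_forall fun y => ?_) (integrable_const_mul_decay_six _)
    (Eventually.of_forall fun y => ?_)
  · exact ((hint.comp (Continuous.prodMk_right s)).congr fun _ => rfl).aestronglyMeasurable
  · have hΩb := norm_lerayVorticity_le_decay hV hD1 s y
    have hDU := norm_fderiv_lerayOrbit_le_decay hV hD1 s y
    have hΩ0 : 0 ≤ ‖curlCLM‖ * C₁ * (1 + ‖y‖) ^ (-(2 : ℝ)) := (norm_nonneg _).trans hΩb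
    have hDU0 : 0 ≤ C₁ * (1 + ‖y‖) ^ (-(2 : ℝ)) := (norm_nonneg _).trans hDU
    calc ‖⟪lerayVorticity V s y, fderiv ℝ (lerayOrbit V s) y (lerayVorticity V s y)⟫‖
        ≤ ‖lerayVorticity V s y‖ * ‖fderiv ℝ (lerayOrbit V s) y (lerayVorticity V s y)‖ :=
          norm_inner_le_norm _ _
      _ ≤ ‖lerayVorticity V s y‖ * (‖fderiv ℝ (lerayOrbit V s) y‖ * ‖lerayVorticity V s y‖) :=
          mul_le_mul_of_nonneg_left (ContinuousLinearMap.le_opNorm _ _) (norm_nonneg _)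
      _ ≤ (‖curlCLM‖ * C₁ * (1 + ‖y‖) ^ (-(2 : ℝ))) *
            ((C₁ * (1 + ‖y‖) ^ (-(2 : ℝ))) * (‖curlCLM‖ * C₁ * (1 + ‖y‖) ^ (-(2 : ℝ)))) := by
          gcongr
      _ = ‖curlCLM‖ ^ 2 * C₁ ^ 3 *
            ((1 + ‖y‖) ^ (-(2 : ℝ)) * (1 + ‖y‖) ^ (-(2 : ℝ)) * (1 + ‖y‖) ^ (-(2 : ℝ))) := by ring
      _ = ‖curlCLM‖ ^ 2 * C₁ ^ 3 * (1 + ‖y‖) ^ (-(6 : ℝ)) := by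
          rw [SlabLaw.rpow_neg_mul_rpow_neg, SlabLaw.rpow_neg_mul_rpow_neg]; norm_num
  · exact (hint.comp (Continuous.prodMk_left y)).congr fun _ => rfl

include hD1 hD2 hD3 in
/-- **`s ↦ Z(s) = ∫‖Ω(s)‖²` is continuous** (it is differentiable, `similarityEnstrophy_hasDerivAt`). -/
theorem continuous_similarityEnstrophy :
    Continuous fun s => ∫ y, ‖lerayVorticity V s y‖ ^ 2 :=
  continuous_iff_continuousAt.2 fun s => (similarityEnstrophy_hasDerivAt hV hD1 hD2 hD3 s).continuousAt

/-! ### The slice identities for the form `P_s(U, U)` -/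

include hD1 hD2 in
/-- **`P_s(U(s), U(s)) = −∫|∇Ω|²_F − ¼Z + 2∫⟪Ω, DU Ω⟫`** (sum over the frame = Frobenius norm,
`U×Ω + U×Ω = 2 U×Ω`, cyclic triple product, and the Lamb form of the stretching). [this file] -/
theorem sliceForm_eq (s : ℝ) :
    (∫ y, (-(∑ i : Fin 3, ⟪fderiv ℝ (lerayVorticity V s) y (EuclideanSpace.single i (1 : ℝ)),
        fderiv ℝ (lerayVorticity V s) y (EuclideanSpace.single i (1 : ℝ))⟫)
        - (1 / 4 : ℝ) * ⟪lerayVorticity V s y, lerayVorticity V s y⟫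
        + ⟪cross (lerayOrbit V s y) (lerayVorticity V s y) + cross (lerayOrbit V s y) (lerayVorticity V s y),
            curl (lerayVorticity V s) y⟫)) =
      -(∫ y, frobeniusNormSq (fderiv ℝ (lerayVorticity V s) y))
        - (1 / 4 : ℝ) * (∫ y, ‖lerayVorticity V s y‖ ^ 2)
        + 2 * ∫ y, ⟪lerayVorticity V s y, fderiv ℝ (lerayOrbit V s) y (lerayVorticity V s y)⟫ := by
  have iF := integrable_frobeniusNormSq_fderiv_lerayVorticity hV hD2 s
  have iZ := integrable_norm_lerayVorticity_sq hV hD1 s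
  have iΛ := integrable_inner_lerayOrbit_lamb hV hD1 hD2 s
  have hpt : ∀ y, (-(∑ i : Fin 3, ⟪fderiv ℝ (lerayVorticity V s) y (EuclideanSpace.single i (1 : ℝ)),
        fderiv ℝ (lerayVorticity V s) y (EuclideanSpace.single i (1 : ℝ))⟫)
        - (1 / 4 : ℝ) * ⟪lerayVorticity V s y, lerayVorticity V s y⟫
        + ⟪cross (lerayOrbit V s y) (lerayVorticity V s y) + cross (lerayOrbit V s y) (lerayVorticity V s y),
            curl (lerayVorticity V s) y⟫) =
      -frobeniusNormSq (fderiv ℝ (lerayVorticity V s) y) - (1 / 4 : ℝ) * ‖lerayVorticity V s y‖ ^ 2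
        + 2 * ⟪lerayOrbit V s y, cross (lerayVorticity V s y) (curl (lerayVorticity V s) y)⟫ := by
    intro y
    rw [sum_inner_apply_single_self, real_inner_self_eq_norm_sq, ← two_smul ℝ, inner_smul_left,
      inner_cross_left_eq_inner_cross_right]
    simp
  rw [integral_congr_ae (Eventually.of_forall hpt)]
  have i1 : Integrable fun y => -frobeniusNormSq (fderiv ℝ (lerayVorticity V s) y) := iF.neg
  have i2 : Integrable fun y => (1 / 4 : ℝ) * ‖lerayVorticity V s y‖ ^ 2 := iZ.const_mul _
  have i3 : Integrable fun y =>
      2 * ⟪lerayOrbit V s y, cross (lerayVorticity V s y) (curl (lerayVorticity V s) y)⟫ :=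
    iΛ.const_mul _
  have e1 : (∫ y, (-frobeniusNormSq (fderiv ℝ (lerayVorticity V s) y) - (1 / 4 : ℝ) * ‖lerayVorticity V s y‖ ^ 2
        + 2 * ⟪lerayOrbit V s y, cross (lerayVorticity V s y) (curl (lerayVorticity V s) y)⟫)) =
      (∫ y, -frobeniusNormSq (fderiv ℝ (lerayVorticity V s) y)) - (∫ y, (1 / 4 : ℝ) * ‖lerayVorticity V s y‖ ^ 2)
        + ∫ y, 2 * ⟪lerayOrbit V s y, cross (lerayVorticity V s y) (curl (lerayVorticity V s) y)⟫ := by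
    have i12 : Integrable fun y => -frobeniusNormSq (fderiv ℝ (lerayVorticity V s) y)
        - (1 / 4 : ℝ) * ‖lerayVorticity V s y‖ ^ 2 := i1.sub i2
    rw [integral_add i12 i3, integral_sub i1 i2]
  rw [e1, integral_neg, integral_const_mul, integral_const_mul,
    integral_stretching_eq_integral_inner_lamb hV hD1 hD2 s]

include hD1 hD2 in
/-- **`∫(Σᵢ‖∂ᵢΩ‖² + ¼‖Ω‖²) = ∫|∇Ω|²_F + ¼Z`.** [this file] -/
theorem sliceDissipation_eq (s : ℝ) :
    (∫ y, ((∑ i : Fin 3, ‖fderiv ℝ (lerayVorticity V s) y (EuclideanSpace.single i (1 : ℝ))‖ ^ 2)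
        + (1 / 4 : ℝ) * ‖lerayVorticity V s y‖ ^ 2)) =
      (∫ y, frobeniusNormSq (fderiv ℝ (lerayVorticity V s) y))
        + (1 / 4 : ℝ) * ∫ y, ‖lerayVorticity V s y‖ ^ 2 := by
  have iF := integrable_frobeniusNormSq_fderiv_lerayVorticity hV hD2 s
  have iZ := integrable_norm_lerayVorticity_sq hV hD1 s
  have hpt : ∀ y, (∑ i : Fin 3, ‖fderiv ℝ (lerayVorticity V s) y (EuclideanSpace.single i (1 : ℝ))‖ ^ 2)
      = frobeniusNormSq (fderiv ℝ (lerayVorticity V s) y) := by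
    intro y
    rw [frobeniusNormSq_eq_sum (EuclideanSpace.basisFun (Fin 3) ℝ)]
    exact Finset.sum_congr rfl fun i _ => by rw [EuclideanSpace.basisFun_apply]
  simp_rw [hpt]
  rw [integral_add iF (iZ.const_mul _), integral_const_mul]

/-! ### The integrated identity -/

include hD1 hD2 hD3 in
/-- **The integrated similarity-enstrophy identity** (`s₁ ≤ s₂`, any order in fact):
`∫_{s₁}^{s₂} P_s(U,U) = Z(s₂) − Z(s₁) + ∫_{s₁}^{s₂}(∫|∇Ω|²_F + ¼Z)`. [this file] -/
theorem integral_sliceForm_eq (s₁ s₂ : ℝ) :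
    ∫ s in s₁..s₂, (∫ y, (-(∑ i : Fin 3, ⟪fderiv ℝ (lerayVorticity V s) y (EuclideanSpace.single i (1 : ℝ)),
        fderiv ℝ (lerayVorticity V s) y (EuclideanSpace.single i (1 : ℝ))⟫)
        - (1 / 4 : ℝ) * ⟪lerayVorticity V s y, lerayVorticity V s y⟫
        + ⟪cross (lerayOrbit V s y) (lerayVorticity V s y) + cross (lerayOrbit V s y) (lerayVorticity V s y),
            curl (lerayVorticity V s) y⟫)) =
      (∫ y, ‖lerayVorticity V s₂ y‖ ^ 2) - (∫ y, ‖lerayVorticity V s₁ y‖ ^ 2)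
        + ∫ s in s₁..s₂, ∫ y, ((∑ i : Fin 3,
            ‖fderiv ℝ (lerayVorticity V s) y (EuclideanSpace.single i (1 : ℝ))‖ ^ 2)
          + (1 / 4 : ℝ) * ‖lerayVorticity V s y‖ ^ 2) := by
  set F : ℝ → ℝ := fun s => ∫ y, frobeniusNormSq (fderiv ℝ (lerayVorticity V s) y) with hF
  set Z : ℝ → ℝ := fun s => ∫ y, ‖lerayVorticity V s y‖ ^ 2 with hZ
  set S : ℝ → ℝ := fun s => ∫ y,
    ⟪lerayVorticity V s y, fderiv ℝ (lerayOrbit V s) y (lerayVorticity V s y)⟫ with hS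
  have cF : Continuous F := continuous_integral_frobeniusNormSq hV hD2
  have cZ : Continuous Z := continuous_similarityEnstrophy hV hD1 hD2 hD3
  have cS : Continuous S := continuous_integral_stretching hV hD1
  have hZ' : ∀ s, HasDerivAt Z (2 * (-F s - (1 / 4) * Z s + S s)) s := fun s =>
    similarityEnstrophy_hasDerivAt hV hD1 hD2 hD3 s
  -- rewrite both interval integrands
  have hL : (fun s => ∫ y, (-(∑ i : Fin 3, ⟪fderiv ℝ (lerayVorticity V s) y (EuclideanSpace.single i (1 : ℝ)),
        fderiv ℝ (lerayVorticity V s) y (EuclideanSpace.single i (1 : ℝ))⟫)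
        - (1 / 4 : ℝ) * ⟪lerayVorticity V s y, lerayVorticity V s y⟫
        + ⟪cross (lerayOrbit V s y) (lerayVorticity V s y) + cross (lerayOrbit V s y) (lerayVorticity V s y),
            curl (lerayVorticity V s) y⟫)) = fun s => -F s - (1 / 4 : ℝ) * Z s + 2 * S s :=
    funext fun s => sliceForm_eq hV hD1 hD2 s
  have hR : (fun s => ∫ y, ((∑ i : Fin 3,
            ‖fderiv ℝ (lerayVorticity V s) y (EuclideanSpace.single i (1 : ℝ))‖ ^ 2)
          + (1 / 4 : ℝ) * ‖lerayVorticity V s y‖ ^ 2)) = fun s => F s + (1 / 4 : ℝ) * Z s :=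
    funext fun s => sliceDissipation_eq hV hD1 hD2 s
  rw [hL, hR]
  -- the fundamental theorem of calculus for `Z`
  have hD : Continuous fun s => 2 * (-F s - (1 / 4) * Z s + S s) := by fun_prop
  have hFTC : ∫ s in s₁..s₂, 2 * (-F s - (1 / 4) * Z s + S s) = Z s₂ - Z s₁ :=
    intervalIntegral.integral_eq_sub_of_hasDerivAt (fun s _ => hZ' s) (hD.intervalIntegrable _ _)
  have i1 : IntervalIntegrable (fun s => 2 * (-F s - (1 / 4) * Z s + S s)) volume s₁ s₂ :=
    hD.intervalIntegrable _ _
  have i2 : IntervalIntegrable (fun s => F s + (1 / 4 : ℝ) * Z s) volume s₁ s₂ := by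
    apply Continuous.intervalIntegrable; fun_prop
  have e : (fun s => -F s - (1 / 4 : ℝ) * Z s + 2 * S s) =
      fun s => 2 * (-F s - (1 / 4) * Z s + S s) + (F s + (1 / 4 : ℝ) * Z s) := by
    funext s; ring
  rw [e, intervalIntegral.integral_add i1 i2, hFTC]

end SliceFunctionals

/-! ### The hypotheses of the item: classical + envelope ⇒ KNSS-gauge Type-I + (D) -/

/-- The envelope at order `n` in product form. [folklore] -/
theorem decay_of_envelope {n : ℕ} {C : ℝ}
    (h : ∀ t < 0, ∀ x : EuclideanSpace ℝ (Fin 3),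
      ‖iteratedFDeriv ℝ n (V t) x‖ ≤ C / (‖x‖ + Real.sqrt (-t)) ^ (n + 1)) :
    ∀ t < 0, ∀ x : EuclideanSpace ℝ (Fin 3),
      (‖x‖ + Real.sqrt (-t)) ^ (n + 1) * ‖iteratedFDeriv ℝ n (V t) x‖ ≤ C := by
  intro t ht x
  have hpos : 0 < (‖x‖ + Real.sqrt (-t)) ^ (n + 1) :=
    pow_pos (add_pos_of_nonneg_of_pos (norm_nonneg _) (Real.sqrt_pos.2 (by linarith))) _
  have := h t ht x
  rw [le_div_iff₀ hpos] at this
  linarith [mul_comm ((‖x‖ + Real.sqrt (-t)) ^ (n + 1)) ‖iteratedFDeriv ℝ n (V t) x‖]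

end AmplitudeMountainPassProof

open AmplitudeMountainPassProof PolyhedralDssProfileExists.Birth Literature.Analysis.FluidPDE in
/-- **Item stmt-NavierStokesRegularity-10564** (`AmplitudeIndex.AmplitudeMountainPass`; card (F1)
"every orbit is enstrophy-unstable along its own amplitude, on average"): the integrated
similarity-enstrophy identity for the Leray orbit of a classical solution with the parabolic Type-I
envelope up to third derivatives. [this file; pub-ns-dss similarity-enstrophy identity + Lamb form] -/
theorem amplitudeIndex_amplitudeMountainPass_proof :
    Summit.NavierStokesRegularity.NavierStokesRegularity.Theses.AmplitudeIndex.AmplitudeMountainPass := by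
  unfold Summit.NavierStokesRegularity.NavierStokesRegularity.Theses.AmplitudeIndex.AmplitudeMountainPass
  intro v p hcl henv s₁ s₂ _hs
  obtain ⟨C₀, hC₀⟩ := henv 0 (by norm_num)
  obtain ⟨C₁, hC₁⟩ := henv 1 (by norm_num)
  obtain ⟨C₂, hC₂⟩ := henv 2 (by norm_num)
  obtain ⟨C₃, hC₃⟩ := henv 3 le_rfl
  have hI : HasTypeIDecay C₀ v := fun t ht x => by
    have h := hC₀ t ht x
    rwa [norm_iteratedFDeriv_zero, zero_add, pow_one] at h
  have hV : IsTypeIAncientMild C₀ v := isTypeIAncientMild_of_classical_typeI hcl hI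
  have hD1 := decay_of_envelope hC₁
  have hD2 := decay_of_envelope hC₂
  have hD3 := decay_of_envelope hC₃
  intro curl' cross' U P
  exact integral_sliceForm_eq hV hD1 hD2 hD3 s₁ s₂

end Summit.NavierStokesRegularity.NavierStokesRegularity.Theorems

end
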